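import Summits.HodgeConjecture.CorCM.GaloisQuaternionCyclicLiftPredicate
import Summits.HodgeConjecture.CorCM.GaloisQuaternionEightCyclicThirteenLift
import Summits.HodgeConjecture.CorCM.GaloisDicyclicNondegenerate
import Mathlib.GroupTheory.SpecificGroups.Quaternion
import HarnessLib

/-!
# `Gal(K/ℚ) ≅ Q_{2ⁿ} × C_p` IS BAD FOR EVERY `n ≥ 3` AND `p ∈ {3, 5, 11, 13, 17, 19, 37, 43}`, AND FOR `n ≥ 4`, `p = 7`
# (the row `Q_{2^k} × C_p` of the seat's table, as a family in `n`)

COR-CM (cell `pub-hodgecm2`), binder seat b04 (gen 39), count-neutral own lane «Galois-CM-type classification» (blanket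
`CorCM/GaloisQuaternion*`).  KERNEL ONLY: theorems; no definition, no named fact, no `sorry`.  `HC_CM` is neither used nor claimed.

The explicit model form of gen 39's lift (`CorCM/GaloisQuaternionCyclicLift`, `…LiftPredicate`, `…EightCyclicThirteenLift`): in
`Q_{4m} × C_p = QuaternionGroup m × C_p` with `m = 2k` the elements `A = (aᵏ, 1)` (order `4`), `X = (x, 1)`, `u = (1, g)` satisfy
`X² = A² = (a^{m}, 1) = c` (the unique involution, `p` odd), `XAX⁻¹ = A⁻¹`, `[A,u] = [X,u] = 1`, `⟨u⟩` central; so every Galois CM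
field with `Gal(K/ℚ) ≅ Q_{8k} × C_p` (`k ≥ 1`: `Q₈, Q₁₆, Q₃₂, …`; as a group `Q_{8k}` need not be a `2`-group, `k` is arbitrary) is BAD for
`p ∈ {3,5,11,13,17,19,37,43}`; with `m = 4k`, `A = (aᵏ, 1)` of order `8`: `Gal ≅ Q_{16k} × C₇` is BAD (`Q₈ × C₇` is GOOD).

* `eq_one_of_mul_self_eq_one_of_odd` (`g² = 1` in `C_p`, `p` odd ⟹ `g = 1`), `map_complexConj_eq_of_mulEquiv_quaternion_prod`
  (`e(c) = (aᵐ, 1)`).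
* **`exists_simple_degenerate_of_mulEquiv_quaternion_prod_cyclic`** (`Q_{8k} × C_p`, eight primes),
  **`exists_simple_degenerate_of_mulEquiv_quaternion_prod_cyclicSeven`** (`Q_{16k} × C₇`).

## References

* [Shimura1998] G. Shimura, *Abelian Varieties with Complex Multiplication and Modular Functions*, §6.2 Thm. 3, §8.2 Prop. 26.
* [Gordon1999HodgeAVSurvey] B. B. Gordon, *A survey of the Hodge conjecture for abelian varieties*, Thm. 6.4, §9.3.
* [Dodson1984] B. Dodson, *The structure of Galois groups of CM-fields*, Trans. AMS 283 (1984), §3.1.1, §5.3.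
-/

noncomputable section

open CategoryTheory CategoryTheory.Limits NumberField
open scoped BigOperators

namespace Summit.HodgeConjecture.CorCM.GaloisModels

open Literature.NumberTheory.ComplexMultiplication
open Literature.AlgebraicGeometry.Motives (AbelianVariety CMType)
open Literature.AlgebraicGeometry.HodgeTheory
open Literature.AlgebraicGeometry.ComplexMultiplication (IsCMTypeRealisation)
open Literature.AlgebraicGeometry.Pohlmann1968
open Literature.Barriers.HodgeConjecture (divisorClassesSpan)
open Summit.HodgeConjecture.CorCM.GaloisRank
open QuaternionGroup

/-! ## §1 The involution of `Q_{4m} × C_p` -/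

section Model

/-- In `C_p` with `p` odd, `g² = 1 ⟹ g = 1`. [folklore] -/
theorem eq_one_of_mul_self_eq_one_of_odd {p : ℕ} [NeZero p] (hp : Odd p) (g : Multiplicative (ZMod p))
    (hg : g * g = 1) : g = 1 := by
  have h2 : orderOf g ∣ 2 := orderOf_dvd_of_pow_eq_one (by rw [pow_two, hg])
  have hp' : orderOf g ∣ p := by
    have h := orderOf_dvd_natCard g
    rwa [Nat.card_eq_fintype_card, Fintype.card_multiplicative, ZMod.card] at h
  have h1 : orderOf g = 1 :=
    Nat.Coprime.eq_one_of_dvd (Nat.Coprime.coprime_dvd_left h2 (Nat.coprime_two_left.mpr hp)) hp'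
  exact orderOf_eq_one_iff.mp h1

variable {K : Type} [Field K] [NumberField K] [IsCMField K]

/-- **Complex conjugation in a model `Gal(K/ℚ) ≅ Q_{4m} × C_p` (`p` odd) is `(aᵐ, 1)`** — the unique involution.
[cite: Dodson1984, §5] -/
theorem map_complexConj_eq_of_mulEquiv_quaternion_prod {m p : ℕ} [NeZero m] [NeZero p] (hp : Odd p)
    (e : (K ≃ₐ[ℚ] K) ≃* QuaternionGroup m × Multiplicative (ZMod p)) :
    e ((IsCMField.complexConj K).restrictScalars ℚ) = (a m, 1) := by
  set y := e ((IsCMField.complexConj K).restrictScalars ℚ) with hy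
  have hyy : y * y = 1 := model_complexConj_mul_self e rfl
  have hy1 : y ≠ 1 := model_complexConj_ne_one e rfl
  have h2 : y.2 = 1 := eq_one_of_mul_self_eq_one_of_odd hp y.2 (by rw [← Prod.snd_mul, hyy, Prod.snd_one])
  have h1 : y.1 = a m := by
    refine GaloisDicyclic.eq_a_of_mul_self_eq_one y.1 (by rw [← Prod.fst_mul, hyy, Prod.fst_one]) fun h => hy1 ?_
    exact Prod.ext h h2
  exact Prod.ext h1 h2

end Model

variable {K : Type} [Field K] [NumberField K] [IsCMField K]

/-! ## §2 `Q_{8k} × C_p`, `p ∈ {3, 5, 11, 13, 17, 19, 37, 43}` -/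

/-- **`Gal(K/ℚ) ≅ Q_{8k} × C_p` IS BAD** for every `k ≥ 1` and `p ∈ {3,5,11,13,17,19,37,43}` (`Q_{8k} = QuaternionGroup (2k)`:
`Q₈ × C_p`, `Q₁₆ × C_p`, `Q₃₂ × C_p`, …): a SIMPLE DEGENERATE CM abelian variety of dimension `[K:ℚ]/2 = 4kp` with a rational `(p,p)`
class outside the divisor ring on some power (the subgroup `⟨(aᵏ,1), (x,1)⟩ × ⟨(1,g)⟩ ≅ Q₈ × C_p` through `c = (a^{2k}, 1)`).
[cite: Shimura1998, §6.2 Thm. 3 and §8.2 Prop. 26] [cite: Gordon1999HodgeAVSurvey, Thm. 6.4 and §9.3] -/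
theorem exists_simple_degenerate_of_mulEquiv_quaternion_prod_cyclic [IsGalois ℚ K] {k p : ℕ} [NeZero k]
    (hp : p = 3 ∨ p = 5 ∨ p = 11 ∨ p = 13 ∨ p = 17 ∨ p = 19 ∨ p = 37 ∨ p = 43)
    (e : (K ≃ₐ[ℚ] K) ≃* QuaternionGroup (2 * k) × Multiplicative (ZMod p)) :
    ∃ (Φ : CMType K) (φ₀ : K →+* ℂ) (A : AbelianVariety ℂ) (ι : 𝓞 K →+* End A)
      (θ : K →+* Module.End ℂ (complexBetti A.X 1)),
      IsPrimitive (ℂ ≃+* ℂ) Φ.1 φ₀ ∧ ¬ IsNondegenerate Φ ∧ IsCMTypeRealisation Φ A ι θ ∧ A.IsSimple ∧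
      A.dim = Module.finrank ℚ K / 2 ∧
      ∃ n p : ℕ, ∃ x : complexBetti (⨁ fun _ : Fin n => A).X (2 * p), IsRationalClass x ∧
        IsOfHodgeType (⨁ fun _ : Fin n => A).dim (⨁ fun _ : Fin n => A).X (2 * p) p p x ∧
        x ∉ divisorClassesSpan (⨁ fun _ : Fin n => A).X (⨁ fun _ : Fin n => A).dim p := by
  have hk : 0 < k := Nat.pos_of_ne_zero (NeZero.ne k)
  haveI : NeZero p := ⟨by rcases hp with rfl | rfl | rfl | rfl | rfl | rfl | rfl | rfl <;> norm_num⟩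
  have hpodd : Odd p := by rcases hp with rfl | rfl | rfl | rfl | rfl | rfl | rfl | rfl <;> decide
  -- the model elements
  set A₀ : QuaternionGroup (2 * k) × Multiplicative (ZMod p) := (a (k : ZMod (2 * (2 * k))), 1) with hA₀
  set X₀ : QuaternionGroup (2 * k) × Multiplicative (ZMod p) := (xa 0, 1) with hX₀
  set u₀ : QuaternionGroup (2 * k) × Multiplicative (ZMod p) := (1, Multiplicative.ofAdd 1) with hu₀
  have hkval : ((k : ℕ) : ZMod (2 * (2 * k))).val = k := by
    rw [ZMod.val_natCast]
    exact Nat.mod_eq_of_lt (by omega)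
  have hA₀ord : orderOf A₀ = 4 := by
    rw [hA₀, Prod.orderOf_mk, orderOf_one, Nat.lcm_one_right, orderOf_a, hkval,
      show 2 * (2 * k) = 4 * k by ring, Nat.gcd_mul_left_left, Nat.mul_div_cancel _ hk]
  have hA₀sq : A₀ ^ 2 = (a (2 * k : ℕ), 1) := by
    rw [hA₀, pow_two, Prod.mk_mul_mk, a_mul_a, mul_one]
    congr 1
    congr 1
    push_cast
    ring
  have hX₀sq : X₀ * X₀ = A₀ ^ 2 := by
    rw [hA₀sq, hX₀, Prod.mk_mul_mk, xa_mul_xa, mul_one]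
    congr 1
    congr 1
    push_cast
    ring
  have hXA₀ : X₀ * A₀ * X₀⁻¹ = A₀⁻¹ := by
    have hinv : A₀⁻¹ = (a (-(k : ZMod (2 * (2 * k)))), 1) := by
      rw [hA₀, Prod.inv_mk, inv_one]
      congr 1
    rw [mul_inv_eq_iff_eq_mul, hinv, hX₀, hA₀, Prod.mk_mul_mk, Prod.mk_mul_mk, xa_mul_a, a_mul_xa, zero_add, zero_sub,
      neg_neg]
  have hcomm : ∀ y : QuaternionGroup (2 * k) × Multiplicative (ZMod p), y * u₀ = u₀ * y := fun y => by
    rw [hu₀]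
    ext
    · simp
    · change y.2 * Multiplicative.ofAdd 1 = Multiplicative.ofAdd 1 * y.2
      exact mul_comm _ _
  have hu₀ord : orderOf u₀ = p := by
    rw [hu₀, Prod.orderOf_mk, orderOf_one, Nat.lcm_one_left, orderOf_ofAdd_eq_addOrderOf, ZMod.addOrderOf_one]
  -- transport to `Gal(K/ℚ)`
  have hc : e ((IsCMField.complexConj K).restrictScalars ℚ) = A₀ ^ 2 := by
    rw [hA₀sq]
    exact map_complexConj_eq_of_mulEquiv_quaternion_prod hpodd e
  have hA : orderOf (e.symm A₀) = 4 := by rw [MulEquiv.orderOf_eq, hA₀ord]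
  have hX : e.symm X₀ * e.symm X₀ = e.symm A₀ ^ 2 := by rw [← map_mul, hX₀sq, map_pow]
  have hXA : e.symm X₀ * e.symm A₀ * (e.symm X₀)⁻¹ = (e.symm A₀)⁻¹ := by
    rw [← map_mul, ← map_inv, ← map_mul, hXA₀, map_inv]
  have hc' : e.symm A₀ ^ 2 = (IsCMField.complexConj K).restrictScalars ℚ := by
    rw [← map_pow, ← hc, MulEquiv.symm_apply_apply]
  have hu : orderOf (e.symm u₀) = p := by rw [MulEquiv.orderOf_eq, hu₀ord]
  have hAu : e.symm A₀ * e.symm u₀ = e.symm u₀ * e.symm A₀ := by rw [← map_mul, hcomm, map_mul]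
  have hXu : e.symm X₀ * e.symm u₀ = e.symm u₀ * e.symm X₀ := by rw [← map_mul, hcomm, map_mul]
  haveI hnorm : (Subgroup.zpowers (e.symm u₀)).Normal := by
    refine ⟨fun n hn g => ?_⟩
    obtain ⟨j, rfl⟩ := Subgroup.mem_zpowers_iff.mp hn
    have hcg : Commute (e.symm u₀) g := by
      have := hcomm (e g)
      apply_fun e.symm at this
      rw [map_mul, map_mul, MulEquiv.symm_apply_apply] at this
      exact this.symm
    rw [← (hcg.zpow_left j).eq, mul_inv_cancel_right]
    exact Subgroup.zpow_mem _ (Subgroup.mem_zpowers _) _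
  rcases hp with rfl | rfl | rfl | rfl | rfl | rfl | rfl | rfl
  · exact exists_simple_degenerate_of_quaternionEight_cyclicThree_subgroup hA hX hXA hc' hu hAu hXu hnorm
  · exact exists_simple_degenerate_of_quaternionEight_cyclicFive_subgroup hA hX hXA hc' hu hAu hXu hnorm
  · exact exists_simple_degenerate_of_quaternionEight_cyclicEleven_subgroup hA hX hXA hc' hu hAu hXu hnorm
  · exact exists_simple_degenerate_of_quaternionEight_cyclicThirteen_subgroup hA hX hXA hc' hu hAu hXu hnorm
  · exact exists_simple_degenerate_of_quaternionEight_cyclic17_subgroup hA hX hXA hc' hu hAu hXu hnorm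
  · exact exists_simple_degenerate_of_quaternionEight_cyclic19_subgroup hA hX hXA hc' hu hAu hXu hnorm
  · exact exists_simple_degenerate_of_quaternionEight_cyclic37_subgroup hA hX hXA hc' hu hAu hXu hnorm
  · exact exists_simple_degenerate_of_quaternionEight_cyclic43_subgroup hA hX hXA hc' hu hAu hXu hnorm

/-! ## §3 `Q_{16k} × C₇` -/

/-- **`Gal(K/ℚ) ≅ Q_{16k} × C₇` IS BAD** for every `k ≥ 1` (`Q_{16k} = QuaternionGroup (4k)`: `Q₁₆ × C₇`, `Q₃₂ × C₇`, …; recall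
`Q₈ × C₇` is GOOD): the subgroup `⟨(aᵏ,1), (x,1)⟩ × ⟨(1,g)⟩ ≅ Q₁₆ × C₇` through `c = (a^{4k}, 1)`.
[cite: Shimura1998, §6.2 Thm. 3 and §8.2 Prop. 26] [cite: Gordon1999HodgeAVSurvey, Thm. 6.4 and §9.3] -/
theorem exists_simple_degenerate_of_mulEquiv_quaternion_prod_cyclicSeven [IsGalois ℚ K] {k : ℕ} [NeZero k]
    (e : (K ≃ₐ[ℚ] K) ≃* QuaternionGroup (4 * k) × Multiplicative (ZMod 7)) :
    ∃ (Φ : CMType K) (φ₀ : K →+* ℂ) (A : AbelianVariety ℂ) (ι : 𝓞 K →+* End A)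
      (θ : K →+* Module.End ℂ (complexBetti A.X 1)),
      IsPrimitive (ℂ ≃+* ℂ) Φ.1 φ₀ ∧ ¬ IsNondegenerate Φ ∧ IsCMTypeRealisation Φ A ι θ ∧ A.IsSimple ∧
      A.dim = Module.finrank ℚ K / 2 ∧
      ∃ n p : ℕ, ∃ x : complexBetti (⨁ fun _ : Fin n => A).X (2 * p), IsRationalClass x ∧
        IsOfHodgeType (⨁ fun _ : Fin n => A).dim (⨁ fun _ : Fin n => A).X (2 * p) p p x ∧
        x ∉ divisorClassesSpan (⨁ fun _ : Fin n => A).X (⨁ fun _ : Fin n => A).dim p := by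
  have hk : 0 < k := Nat.pos_of_ne_zero (NeZero.ne k)
  set A₀ : QuaternionGroup (4 * k) × Multiplicative (ZMod 7) := (a (k : ZMod (2 * (4 * k))), 1) with hA₀
  set X₀ : QuaternionGroup (4 * k) × Multiplicative (ZMod 7) := (xa 0, 1) with hX₀
  set u₀ : QuaternionGroup (4 * k) × Multiplicative (ZMod 7) := (1, Multiplicative.ofAdd 1) with hu₀
  have hkval : ((k : ℕ) : ZMod (2 * (4 * k))).val = k := by
    rw [ZMod.val_natCast]
    exact Nat.mod_eq_of_lt (by omega)
  have hA₀ord : orderOf A₀ = 8 := by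
    rw [hA₀, Prod.orderOf_mk, orderOf_one, Nat.lcm_one_right, orderOf_a, hkval,
      show 2 * (4 * k) = 8 * k by ring, Nat.gcd_mul_left_left, Nat.mul_div_cancel _ hk]
  have hA₀4 : A₀ ^ 4 = (a (4 * k : ℕ), 1) := by
    rw [hA₀, show (4 : ℕ) = 2 + 2 by rfl, pow_add, pow_two, Prod.mk_mul_mk, Prod.mk_mul_mk, a_mul_a, a_mul_a, mul_one,
      mul_one]
    congr 1
    congr 1
    push_cast
    ring
  have hX₀sq : X₀ * X₀ = A₀ ^ 4 := by
    rw [hA₀4, hX₀, Prod.mk_mul_mk, xa_mul_xa, mul_one]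
    congr 1
    congr 1
    push_cast
    ring
  have hXA₀ : X₀ * A₀ * X₀⁻¹ = A₀⁻¹ := by
    have hinv : A₀⁻¹ = (a (-(k : ZMod (2 * (4 * k)))), 1) := by
      rw [hA₀, Prod.inv_mk, inv_one]
      congr 1
    rw [mul_inv_eq_iff_eq_mul, hinv, hX₀, hA₀, Prod.mk_mul_mk, Prod.mk_mul_mk, xa_mul_a, a_mul_xa, zero_add, zero_sub,
      neg_neg]
  have hcomm : ∀ y : QuaternionGroup (4 * k) × Multiplicative (ZMod 7), y * u₀ = u₀ * y := fun y => by
    rw [hu₀]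
    ext
    · simp
    · change y.2 * Multiplicative.ofAdd 1 = Multiplicative.ofAdd 1 * y.2
      exact mul_comm _ _
  have hu₀ord : orderOf u₀ = 7 := by
    rw [hu₀, Prod.orderOf_mk, orderOf_one, Nat.lcm_one_left, orderOf_ofAdd_eq_addOrderOf, ZMod.addOrderOf_one]
  have hc : e ((IsCMField.complexConj K).restrictScalars ℚ) = A₀ ^ 4 := by
    rw [hA₀4]
    exact map_complexConj_eq_of_mulEquiv_quaternion_prod (by decide) e
  have hA : orderOf (e.symm A₀) = 8 := by rw [MulEquiv.orderOf_eq, hA₀ord]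
  have hX : e.symm X₀ * e.symm X₀ = e.symm A₀ ^ 4 := by rw [← map_mul, hX₀sq, map_pow]
  have hXA : e.symm X₀ * e.symm A₀ * (e.symm X₀)⁻¹ = (e.symm A₀)⁻¹ := by
    rw [← map_mul, ← map_inv, ← map_mul, hXA₀, map_inv]
  have hc' : e.symm A₀ ^ 4 = (IsCMField.complexConj K).restrictScalars ℚ := by
    rw [← map_pow, ← hc, MulEquiv.symm_apply_apply]
  have hu : orderOf (e.symm u₀) = 7 := by rw [MulEquiv.orderOf_eq, hu₀ord]
  have hAu : e.symm A₀ * e.symm u₀ = e.symm u₀ * e.symm A₀ := by rw [← map_mul, hcomm, map_mul]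
  have hXu : e.symm X₀ * e.symm u₀ = e.symm u₀ * e.symm X₀ := by rw [← map_mul, hcomm, map_mul]
  haveI hnorm : (Subgroup.zpowers (e.symm u₀)).Normal := by
    refine ⟨fun n hn g => ?_⟩
    obtain ⟨j, rfl⟩ := Subgroup.mem_zpowers_iff.mp hn
    have hcg : Commute (e.symm u₀) g := by
      have := hcomm (e g)
      apply_fun e.symm at this
      rw [map_mul, map_mul, MulEquiv.symm_apply_apply] at this
      exact this.symm
    rw [← (hcg.zpow_left j).eq, mul_inv_cancel_right]
    exact Subgroup.zpow_mem _ (Subgroup.mem_zpowers _) _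
  exact exists_simple_degenerate_of_quaternionSixteen_cyclicSeven_subgroup hA hX hXA hc' hu hAu hXu hnorm

end Summit.HodgeConjecture.CorCM.GaloisModels

end
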